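import Summits.ValiantsHypothesis.ValiantsHypothesis.Theorems.LacunarySymmetroidMatrixDescartesWLawTwoSix
import Summits.ValiantsHypothesis.ValiantsHypothesis.Theorems.LacunarySymmetroidMatrixDescartesOneAlternation
import Summits.ValiantsHypothesis.ValiantsHypothesis.Theorems.LacunarySymmetroidMatrixDescartesCensusEndWindowRev

/-!
# `MatrixDescartes` (stmt-ValiantsHypothesis-18050) — the `(m, K) = (2, 3)` PIVOT ROW IS EXACTLY SIX:
# `PivotRootLawAt 2 3 q 6` for every index `q` (the Λ-law by reversal, the one-sided shapes, ties)

HONEST FRAMING.  Cell `pub-symmetroid`, seat `val-sym-mdr-p1` (gen 5); helper `--supports` the crux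
`Theses.LacunarySymmetroid.MatrixDescartes` (OPEN, on HOLD), NO closure claim.  In conjb-1's pivot currency
(`…CensusPivotDefs`: `PivotRootLawAt m K q B` — every `m × m` pivot pencil `X^e J + ∑ₖ X^{dₖ} Pₖ` with `J` symmetric of
negative index `≤ q` and `K` PSD letters has `Z₊ ≤ B`) the tree had R1₂ `PivotRootLawAt 2 K q (2K + 2)` (conjb-1 g0), i.e.
`8` at `K = 3`.  This file proves the SHARP row **`pivotRootLawAt_two_three : PivotRootLawAt 2 3 q 6`** (attained by the
W-witness `WLawTwoWitness`, so the `(2, 3)` pivot constant is exactly `6 = 2K` for every index; `not_pivotRootLawAt_two_three_five`).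
Cases of a `2 × 2` pivot pencil with three PSD letters: a coincidence among `e, d₀, d₁, d₂` leaves at most three pivot
degrees (`Z₊ ≤ 6` by the tree's negative-support budget `Pivot.TwoDescartes.card_posRoots_le_two_mul_card`); otherwise,
sorted, the shape is `(3|0)` or `(0|3)` (ONE-SIDED: Loewner-monotone, `Z₊ ≤ 2` by the tree's `oneAlternation` /
`oneAlternation_mirror`), `(2|1)` (the W-law `WLawTwoSix.wLawTwo_posRoots_le_six`, `Z₊ ≤ 6`) or `(1|2)` (the Λ-LAW
`lambdaLawTwo_posRoots_le_six`, `Z₊ ≤ 6`, = the W-law read through `x ↦ 1/x`: `reflect_det_wPencil`).  Nothing here bears on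
`K ≥ 4` (located floor `2K − 3`, R1₂ ceiling `2K + 2`), on `MatrixDescartes` in its window, `DoorA26`/`DoorA34`, the
cell's registers, or `VP ≠ VNP`.

[folklore] polynomial reversal (Mathlib `Polynomial.reflect`), Loewner monotonicity (tree), the W-law (tree); no single source.
-/

-- `Summit.ValiantsHypothesis.ValiantsHypothesis.…` repeats a component by the D-0017 layout
-- (single-conjunct summit), which the `dupNamespace` linter flags; the name is mandated.
set_option linter.dupNamespace false

namespace Summit.ValiantsHypothesis.ValiantsHypothesis.Theorems.LacunarySymmetroidMatrixDescartes

open Polynomial Finset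
open scoped BigOperators Polynomial Matrix

namespace WLawTwoSix

/-! ### 1. Reversal of the four-letter `2 × 2` pencil -/

/-- **Reversal.**  For `N` at least every exponent, `X^{2N} · det F(1/X)` (Mathlib `reflect (N+N)`) of the four-letter
`2 × 2` pencil is the determinant of the pencil with exponents `N − ·` (`J` arbitrary, `P₁, P₂, Q` symmetric). [folklore] -/
theorem reflect_det_wPencil (e d₁ d₂ d₃ N : ℕ) (J P₁ P₂ Q : Matrix (Fin 2) (Fin 2) ℝ)
    (hP₁ : P₁ 1 0 = P₁ 0 1) (hP₂ : P₂ 1 0 = P₂ 0 1) (hQ : Q 1 0 = Q 0 1)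
    (he : e ≤ N) (h₁ : d₁ ≤ N) (h₂ : d₂ ≤ N) (h₃ : d₃ ≤ N) :
    reflect (N + N) (Matrix.det (((X : ℝ[X]) ^ e) • J.map C + ((X : ℝ[X]) ^ d₁) • P₁.map C
        + ((X : ℝ[X]) ^ d₂) • P₂.map C + ((X : ℝ[X]) ^ d₃) • Q.map C))
      = Matrix.det (((X : ℝ[X]) ^ (N - e)) • J.map C + ((X : ℝ[X]) ^ (N - d₁)) • P₁.map C
        + ((X : ℝ[X]) ^ (N - d₂)) • P₂.map C + ((X : ℝ[X]) ^ (N - d₃)) • Q.map C) := by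
  rw [det_wPencil_eq e d₁ d₂ d₃ J P₁ P₂ Q hP₁ hP₂ hQ,
    det_wPencil_eq (N - e) (N - d₁) (N - d₂) (N - d₃) J P₁ P₂ Q hP₁ hP₂ hQ]
  simp only [reflect_add, reflect_C_mul_X_pow]
  have r1 : revAt (N + N) (d₂ + d₂) = N - d₂ + (N - d₂) := by rw [revAt_le (by omega)]; omega
  have r2 : revAt (N + N) (d₁ + d₂) = N - d₁ + (N - d₂) := by rw [revAt_le (by omega)]; omega
  have r3 : revAt (N + N) (e + d₂) = N - e + (N - d₂) := by rw [revAt_le (by omega)]; omega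
  have r4 : revAt (N + N) (d₁ + d₁) = N - d₁ + (N - d₁) := by rw [revAt_le (by omega)]; omega
  have r5 : revAt (N + N) (e + d₁) = N - e + (N - d₁) := by rw [revAt_le (by omega)]; omega
  have r6 : revAt (N + N) (d₂ + d₃) = N - d₂ + (N - d₃) := by rw [revAt_le (by omega)]; omega
  have r7 : revAt (N + N) (e + e) = N - e + (N - e) := by rw [revAt_le (by omega)]; omega
  have r8 : revAt (N + N) (d₁ + d₃) = N - d₁ + (N - d₃) := by rw [revAt_le (by omega)]; omega
  have r9 : revAt (N + N) (e + d₃) = N - e + (N - d₃) := by rw [revAt_le (by omega)]; omega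
  have r10 : revAt (N + N) (d₃ + d₃) = N - d₃ + (N - d₃) := by rw [revAt_le (by omega)]; omega
  rw [r1, r2, r3, r4, r5, r6, r7, r8, r9, r10]

/-- The determinant of the four-letter `2 × 2` pencil has degree at most twice the largest exponent. [folklore] -/
theorem natDegree_det_wPencil_le (e d₁ d₂ d₃ N : ℕ) (J P₁ P₂ Q : Matrix (Fin 2) (Fin 2) ℝ)
    (hP₁ : P₁ 1 0 = P₁ 0 1) (hP₂ : P₂ 1 0 = P₂ 0 1) (hQ : Q 1 0 = Q 0 1)
    (he : e ≤ N) (h₁ : d₁ ≤ N) (h₂ : d₂ ≤ N) (h₃ : d₃ ≤ N) :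
    (Matrix.det (((X : ℝ[X]) ^ e) • J.map C + ((X : ℝ[X]) ^ d₁) • P₁.map C
        + ((X : ℝ[X]) ^ d₂) • P₂.map C + ((X : ℝ[X]) ^ d₃) • Q.map C)).natDegree ≤ N + N := by
  rw [det_wPencil_eq e d₁ d₂ d₃ J P₁ P₂ Q hP₁ hP₂ hQ]
  have t : ∀ (c : ℝ) (n : ℕ), n ≤ N + N → (C c * X ^ n).natDegree ≤ N + N :=
    fun c n hn => (natDegree_C_mul_X_pow_le c n).trans hn
  refine (natDegree_add_le _ _).trans (max_le ?_ (t _ _ (by omega)))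
  refine (natDegree_add_le _ _).trans (max_le ?_ (t _ _ (by omega)))
  refine (natDegree_add_le _ _).trans (max_le ?_ (t _ _ (by omega)))
  refine (natDegree_add_le _ _).trans (max_le ?_ (t _ _ (by omega)))
  refine (natDegree_add_le _ _).trans (max_le ?_ (t _ _ (by omega)))
  refine (natDegree_add_le _ _).trans (max_le ?_ (t _ _ (by omega)))
  refine (natDegree_add_le _ _).trans (max_le ?_ (t _ _ (by omega)))
  refine (natDegree_add_le _ _).trans (max_le ?_ (t _ _ (by omega)))
  refine (natDegree_add_le _ _).trans (max_le ?_ (t _ _ (by omega)))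
  exact t _ _ (by omega)

/-! ### 2. The Λ-law: one PSD letter below the pivot, two above -/

/-- Symmetry of a PSD real matrix in entry form. -/
theorem psd_symm_entry {P : Matrix (Fin 2) (Fin 2) ℝ} (hP : P.PosSemidef) : P 1 0 = P 0 1 :=
  (Pivot.TwoDescartes.psd_two_facts hP).2.2.1

/-- **The Λ-law at `n = 2`**: a `2 × 2` pencil `X^e J + X^{a₁} A₁ + X^{a₂} A₂ + X^{b} B` with `b < e < a₁ < a₂` (ONE PSD
letter below the pivot, TWO above; `J` any real `2 × 2` matrix) has at most six distinct positive zeros of its determinant —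
the W-law read through `x ↦ 1/x` (`reflect_det_wPencil` + tree `Census.card_posRoots_le_card_posRoots_reflect`). [folklore] -/
theorem lambdaLawTwo_posRoots_le_six (e a₁ a₂ b : ℕ) (J A₁ A₂ B : Matrix (Fin 2) (Fin 2) ℝ)
    (hA₁ : A₁.PosSemidef) (hA₂ : A₂.PosSemidef) (hB : B.PosSemidef)
    (hbe : b < e) (he₁ : e < a₁) (h₁₂ : a₁ < a₂) :
    ((Matrix.det (((X : ℝ[X]) ^ e) • J.map C + ((X : ℝ[X]) ^ a₁) • A₁.map C
        + ((X : ℝ[X]) ^ a₂) • A₂.map C + ((X : ℝ[X]) ^ b) • B.map C)).roots.toFinset.filter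
          (fun t => 0 < t)).card ≤ 6 := by
  set f := Matrix.det (((X : ℝ[X]) ^ e) • J.map C + ((X : ℝ[X]) ^ a₁) • A₁.map C
        + ((X : ℝ[X]) ^ a₂) • A₂.map C + ((X : ℝ[X]) ^ b) • B.map C) with hf
  by_cases hf0 : f = 0
  · rw [hf0]; simp
  have hrefl := Census.card_posRoots_le_card_posRoots_reflect f hf0
    (natDegree_det_wPencil_le e a₁ a₂ b a₂ J A₁ A₂ B (psd_symm_entry hA₁) (psd_symm_entry hA₂) (psd_symm_entry hB)
      (by omega) (by omega) le_rfl (by omega))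
  rw [hf, reflect_det_wPencil e a₁ a₂ b a₂ J A₁ A₂ B (psd_symm_entry hA₁) (psd_symm_entry hA₂) (psd_symm_entry hB)
    (by omega) (by omega) le_rfl (by omega)] at hrefl
  exact hrefl.trans (wLawTwo_posRoots_le_six (a₂ - e) (a₂ - a₁) (a₂ - a₂) (a₂ - b) J A₁ A₂ B hA₁ hA₂ hB
    (by omega) (by omega) (by omega))

/-! ### 3. The one-sided shapes -/

/-- Symmetry of a PSD real matrix. -/
theorem psd_isSymm {P : Matrix (Fin 2) (Fin 2) ℝ} (hP : P.PosSemidef) : P.IsSymm := by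
  have h := hP.1
  rwa [Matrix.IsHermitian, Matrix.conjTranspose_eq_transpose_of_trivial] at h

/-- the four-letter pencil as a `Fin 4`-sum -/
theorem wPencil_eq_sum_four (e d₁ d₂ d₃ : ℕ) (J P₁ P₂ P₃ : Matrix (Fin 2) (Fin 2) ℝ) :
    ((X : ℝ[X]) ^ e) • J.map C + ((X : ℝ[X]) ^ d₁) • P₁.map C + ((X : ℝ[X]) ^ d₂) • P₂.map C
        + ((X : ℝ[X]) ^ d₃) • P₃.map C
      = ∑ k : Fin 4, ((X : ℝ[X]) ^ (![e, d₁, d₂, d₃] k)) • ((![J, P₁, P₂, P₃] k).map C) := by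
  simp only [Fin.sum_univ_four, Matrix.cons_val_zero, Matrix.cons_val_one, Matrix.cons_val_two,
    Matrix.cons_val_three, Matrix.head_cons, Matrix.tail_cons]

/-- **One-sided, all PSD letters BELOW the pivot** (`dᵢ < e`, `J` symmetric): `Z₊ ≤ 2` — `F/x^e` is Loewner
non-increasing (tree `oneAlternation`). [folklore] -/
theorem oneSidedBelow_posRoots_le_two (e d₁ d₂ d₃ : ℕ) (J P₁ P₂ P₃ : Matrix (Fin 2) (Fin 2) ℝ) (hJ : J.IsSymm)
    (hP₁ : P₁.PosSemidef) (hP₂ : P₂.PosSemidef) (hP₃ : P₃.PosSemidef)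
    (h₁ : d₁ < e) (h₂ : d₂ < e) (h₃ : d₃ < e) :
    ((Matrix.det (((X : ℝ[X]) ^ e) • J.map C + ((X : ℝ[X]) ^ d₁) • P₁.map C
        + ((X : ℝ[X]) ^ d₂) • P₂.map C + ((X : ℝ[X]) ^ d₃) • P₃.map C)).roots.toFinset.filter
          (fun t => 0 < t)).card ≤ 2 := by
  rw [wPencil_eq_sum_four]
  have h := oneAlternation (Fin 2) (Fin 4) e ![e, d₁, d₂, d₃] ![J, P₁, P₂, P₃] ?_ ?_ ?_
  · simpa using h
  · intro k; fin_cases k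
    · exact hJ
    · exact psd_isSymm hP₁
    · exact psd_isSymm hP₂
    · exact psd_isSymm hP₃
  · intro k hk; fin_cases k
    · exact absurd hk (lt_irrefl _)
    · exact hP₁
    · exact hP₂
    · exact hP₃
  · intro k hk; fin_cases k
    · exact absurd hk (lt_irrefl _)
    · exact absurd hk (by simp; omega)
    · exact absurd hk (by simp; omega)
    · exact absurd hk (by simp; omega)

/-- **One-sided, all PSD letters ABOVE the pivot** (`e < dᵢ`, `J` symmetric): `Z₊ ≤ 2` — `F/x^e` is Loewner
non-decreasing (tree `oneAlternation_mirror`). [folklore] -/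
theorem oneSidedAbove_posRoots_le_two (e d₁ d₂ d₃ : ℕ) (J P₁ P₂ P₃ : Matrix (Fin 2) (Fin 2) ℝ) (hJ : J.IsSymm)
    (hP₁ : P₁.PosSemidef) (hP₂ : P₂.PosSemidef) (hP₃ : P₃.PosSemidef)
    (h₁ : e < d₁) (h₂ : e < d₂) (h₃ : e < d₃) :
    ((Matrix.det (((X : ℝ[X]) ^ e) • J.map C + ((X : ℝ[X]) ^ d₁) • P₁.map C
        + ((X : ℝ[X]) ^ d₂) • P₂.map C + ((X : ℝ[X]) ^ d₃) • P₃.map C)).roots.toFinset.filter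
          (fun t => 0 < t)).card ≤ 2 := by
  rw [wPencil_eq_sum_four]
  have h := oneAlternation_mirror (Fin 2) (Fin 4) e ![e, d₁, d₂, d₃] ![J, P₁, P₂, P₃] ?_ ?_ ?_
  · simpa using h
  · intro k; fin_cases k
    · exact hJ
    · exact psd_isSymm hP₁
    · exact psd_isSymm hP₂
    · exact psd_isSymm hP₃
  · intro k hk; fin_cases k
    · exact absurd hk (lt_irrefl _)
    · exact absurd hk (by simp; omega)
    · exact absurd hk (by simp; omega)
    · exact absurd hk (by simp; omega)
  · intro k hk; fin_cases k
    · exact absurd hk (lt_irrefl _)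
    · exact hP₁
    · exact hP₂
    · exact hP₃


/-! ### 4. The `(2, 3)` pivot row -/

/-- **Every `2 × 2` pivot pencil with THREE PSD letters has `Z₊ ≤ 6`** (`J` symmetric of any signature, any exponents
`e, d₀, d₁, d₂`, ties allowed): a coincidence among `2e, e + dₖ` leaves at most three pivot degrees (negative-support
budget, `≤ 6`); otherwise, after sorting, the shape is `(3|0)` / `(0|3)` (`≤ 2`), `(2|1)` (W-law, `≤ 6`) or `(1|2)` (Λ-law,
`≤ 6`). [folklore] -/
theorem pivotTwoThree_posRoots_le_six (e : ℕ) (d : Fin 3 → ℕ) (J : Matrix (Fin 2) (Fin 2) ℝ)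
    (P : Fin 3 → Matrix (Fin 2) (Fin 2) ℝ) (hJ : J.IsSymm) (hP : ∀ k, (P k).PosSemidef) :
    ((Matrix.det (((X : ℝ[X]) ^ e) • J.map C + ∑ k, ((X : ℝ[X]) ^ d k) • (P k).map C)).roots.toFinset.filter
      (fun t => 0 < t)).card ≤ 6 := by
  classical
  by_cases hgen : Function.Injective d ∧ ∀ k, d k ≠ e
  · obtain ⟨hinj, hne⟩ := hgen
    set σ : Equiv.Perm (Fin 3) := Tuple.sort d with hσ
    have hmono : Monotone (d ∘ σ) := Tuple.monotone_sort d
    have hsm : StrictMono (d ∘ σ) := hmono.strictMono_of_injective (hinj.comp σ.injective)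
    have hsum : (∑ k, ((X : ℝ[X]) ^ d k) • (P k).map C) = ∑ k, ((X : ℝ[X]) ^ d (σ k)) • (P (σ k)).map C :=
      (Equiv.sum_comp σ (fun k => ((X : ℝ[X]) ^ d k) • (P k).map C)).symm
    rw [hsum, Fin.sum_univ_three, ← add_assoc, ← add_assoc]
    have h01 : d (σ 0) < d (σ 1) := hsm (show (0 : Fin 3) < 1 by decide)
    have h12 : d (σ 1) < d (σ 2) := hsm (show (1 : Fin 3) < 2 by decide)
    rcases lt_or_gt_of_ne (hne (σ 0)) with h0 | h0
    · rcases lt_or_gt_of_ne (hne (σ 1)) with h1 | h1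
      · rcases lt_or_gt_of_ne (hne (σ 2)) with h2 | h2
        · -- shape (3|0)
          exact (oneSidedBelow_posRoots_le_two e _ _ _ J _ _ _ hJ (hP _) (hP _) (hP _) h0 h1 h2).trans (by norm_num)
        · -- shape (2|1): the W-law with `d₂ = d(σ0) < d₁ = d(σ1) < e < d₃ = d(σ2)`
          rw [add_right_comm (((X : ℝ[X]) ^ e) • J.map C)]
          exact wLawTwo_posRoots_le_six e (d (σ 1)) (d (σ 0)) (d (σ 2)) J (P (σ 1)) (P (σ 0)) (P (σ 2))
            (hP _) (hP _) (hP _) h01 h1 h2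
      · -- shape (1|2): the Λ-law with `b = d(σ0) < e < a₁ = d(σ1) < a₂ = d(σ2)`
        have h2 : e < d (σ 2) := lt_trans h1 h12
        rw [add_right_comm (((X : ℝ[X]) ^ e) • J.map C), add_right_comm (((X : ℝ[X]) ^ e) • J.map C + _)]
        exact lambdaLawTwo_posRoots_le_six e (d (σ 1)) (d (σ 2)) (d (σ 0)) J (P (σ 1)) (P (σ 2)) (P (σ 0))
          (hP _) (hP _) (hP _) h0 h1 h12
    · -- shape (0|3)
      have h1 : e < d (σ 1) := lt_trans h0 h01
      have h2 : e < d (σ 2) := lt_trans h1 h12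
      exact (oneSidedAbove_posRoots_le_two e _ _ _ J _ _ _ hJ (hP _) (hP _) (hP _) h0 h1 h2).trans (by norm_num)
  · -- a coincidence: at most three pivot degrees
    rw [Pivot.TwoDescartes.pencil_eq_sum]
    set T : Finset ℕ := (Finset.univ : Finset (Option (Fin 3))).image
      (fun l => e + Pivot.TwoDescartes.expo e d l) with hT
    have hT3 : T.card ≤ 3 := by
      have hle : T.card ≤ 4 := by
        refine (Finset.card_image_le).trans ?_
        simp
      by_contra h4
      have hT4 : T.card = (Finset.univ : Finset (Option (Fin 3))).card := by
        simp only [Finset.card_univ, Fintype.card_option, Fintype.card_fin]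
        omega
      have hinjOn := Finset.injOn_of_card_image_eq hT4
      apply hgen
      refine ⟨fun i j hij => ?_, fun k hk => ?_⟩
      · have := hinjOn (Finset.mem_univ (some i)) (Finset.mem_univ (some j))
          (by simp only [Pivot.TwoDescartes.expo]; rw [hij])
        exact Option.some_injective _ this
      · have := hinjOn (Finset.mem_univ (some k)) (Finset.mem_univ none)
          (by simp only [Pivot.TwoDescartes.expo]; rw [hk])
        exact Option.some_ne_none k this
    have hneg := fun n hn => WLawTwoChambers.neg_mem_image e d J P hP n hn
    exact (Pivot.TwoDescartes.card_posRoots_le_two_mul_card _ T hneg).trans (by omega)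

end WLawTwoSix

/-- **THE `(2, 3)` PIVOT ROW: `PivotRootLawAt 2 3 q 6` for every index `q`** — a `2 × 2` pivot pencil with three PSD
letters has at most six distinct positive determinant zeros (vs the tree's R1₂ `2K + 2 = 8`).  Sharp at index `q ≥ 1` by
the W-witness (`not_pivotRootLawAt_two_three_one_five`). [folklore] -/
theorem pivotRootLawAt_two_three (q : ℕ) : Pivot.PivotRootLawAt 2 3 q 6 := by
  intro e d J P hJ hP _hW
  unfold Pivot.pivotPosRoots
  exact WLawTwoSix.pivotTwoThree_posRoots_le_six e d J P hJ hP

/-- **The `(2, 3)` pivot constant at index `1` is exactly six**: `¬ PivotRootLawAt 2 3 1 5` — the W-witness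
`WLawTwoWitness` (`J = [[620, −260], [−260, −2720]]` has negative index one: `J + W Wᵀ = diag(624, 14180) ⪰ 0` for
`W = (2, 130)ᵀ`) has six positive zeros. [folklore] -/
theorem not_pivotRootLawAt_two_three_one_five : ¬ Pivot.PivotRootLawAt 2 3 1 5 := by
  intro h
  have h6 := WLawTwoWitness.six_le_card_posRoots_Fw
  have hJ : (!![620, -260; -260, -2720] : Matrix (Fin 2) (Fin 2) ℝ).IsSymm :=
    Matrix.IsSymm.ext fun i j => by fin_cases i <;> fin_cases j <;> simp
  have hP : ∀ k : Fin 3, ((![(Matrix.vecMulVec ![(20 : ℝ), 38] ![(20 : ℝ), 38] : Matrix (Fin 2) (Fin 2) ℝ),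
      (Matrix.vecMulVec ![(20 : ℝ), 32] ![(20 : ℝ), 32]
        + Matrix.vecMulVec ![(15 : ℝ), 23] ![(15 : ℝ), 23] : Matrix (Fin 2) (Fin 2) ℝ),
      (Matrix.vecMulVec ![(-9 : ℝ), 20] ![(-9 : ℝ), 20]
        + Matrix.vecMulVec ![(-6 : ℝ), 13] ![(-6 : ℝ), 13] : Matrix (Fin 2) (Fin 2) ℝ)] :
      Fin 3 → Matrix (Fin 2) (Fin 2) ℝ) k).PosSemidef := by
    intro k
    fin_cases k
    · simpa using WLawTwoWitness.Pw₁_posSemidef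
    · simpa using WLawTwoWitness.Pw₂_posSemidef
    · simpa using WLawTwoWitness.Qw_posSemidef
  have hW : ∃ W : Matrix (Fin 2) (Fin 1) ℝ,
      ((!![620, -260; -260, -2720] : Matrix (Fin 2) (Fin 2) ℝ) + W * Wᵀ).PosSemidef := by
    refine ⟨(!![2; 130] : Matrix (Fin 2) (Fin 1) ℝ), ?_⟩
    have hdiag : ((!![620, -260; -260, -2720] : Matrix (Fin 2) (Fin 2) ℝ)
          + (!![2; 130] : Matrix (Fin 2) (Fin 1) ℝ) * (!![2; 130] : Matrix (Fin 2) (Fin 1) ℝ)ᵀ)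
        = Matrix.diagonal ![(624 : ℝ), 14180] := by
      ext i j
      fin_cases i <;> fin_cases j <;>
        norm_num [Matrix.mul_apply, Matrix.diagonal, Matrix.transpose_apply, Matrix.vecHead, Matrix.vecTail]
    rw [hdiag, Matrix.posSemidef_diagonal_iff]
    intro i
    fin_cases i <;> norm_num
  have h5 := h 3 ![2, 0, 5] _ _ hJ hP hW
  unfold Pivot.pivotPosRoots at h5
  simp only [Fin.sum_univ_three, Matrix.cons_val_zero, Matrix.cons_val_one, Matrix.cons_val_two,
    Matrix.head_cons, Matrix.tail_cons, ← add_assoc] at h5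
  exact absurd (h6.trans h5) (by norm_num)

/-- **Exact row**: `PivotRootLawAt 2 3 1 B ↔ 6 ≤ B`. [folklore] -/
theorem pivotRootLawAt_two_three_one_iff (B : ℕ) : Pivot.PivotRootLawAt 2 3 1 B ↔ 6 ≤ B := by
  constructor
  · intro h
    by_contra hB
    exact not_pivotRootLawAt_two_three_one_five (Pivot.pivotRootLawAt_mono h (by omega))
  · intro hB
    exact Pivot.pivotRootLawAt_mono (pivotRootLawAt_two_three 1) hB

end Summit.ValiantsHypothesis.ValiantsHypothesis.Theorems.LacunarySymmetroidMatrixDescartes
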